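import Mathlib
import HarnessLib
import Summits.HubbardSuperconductivity.HubbardSuperconductivity.Theorems.KLProgrammeKLRegimeFlowReadTransportZFitWord
import Summits.HubbardSuperconductivity.HubbardSuperconductivity.Theorems.KLProgrammeKLRegimeEngineV8DefsU12bGQ
import Summits.HubbardSuperconductivity.HubbardSuperconductivity.Theorems.KLProgrammeKLRegimeEngineV8DefsQ9dG
import Summits.HubbardSuperconductivity.HubbardSuperconductivity.Theorems.KLProgrammeKLRegimeEngineV8DefsG14

/-!
# Route `KLProgramme` — ENGINE item stmt-HubbardSuperconductivity-20437 `KLRegimeEngineV17F2`, registration r16 V2 (α1) «A24∪A25∪Z∪α1»-G14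
# (image 27cd7ed0f55f17c0): ROW (C) `stub_twoLeg_curvature` 7138417578ff — «U-DOOR-FROM-TOKEN»: the two `U`-doors of the (C) closer's `hres` package
# follow from token #14 (cell gate-hubbard-kl, seat p2 g27)

WHAT.  The (C) closer of record `A24a1G14.stub_twoLeg_curvature_of_producers hexZ hcertA hres` (…EngineV17F2ClosersCGQInst, p709580) carries inside its `hres` package two
`U`-DOORS of the frame-shift reading chain (…FlowEnvelopeChoice `Gfr_mul_Theta_inv_pow_le_klScale_div_four`, the one-call drivers' `hdoor` / `hdoor₁`):
`R.Gfr 0·|U| + (Σ_{j<5} R.Gfr j + π⁸·W/2¹¹)·U² ≤ 1/128` with `W = curveExtC X₄ klEngGeo14.S 1 + curveExtC X₄ (klEngQ9dG klEngGeo14 P R).S' 1·|U|`, `X₄ = 8·576·342⁴`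
(regular steps, CGQInst l.54) and the same with `klChi2CauchyTab2 4 = 65550` in place of `X₄` and `1/512` (last index, l.201).  This file DISCHARGES both from row (C)'s own
prefix: `R.WF2`, `0 < U ≤ klEngU₀12GQ klEngGeo14 (klEngQ9dG klEngGeo14 P R) P R c` — through `klEngU₀12GQ_le_klEngU₀3`,
`klEngU₀3 P R c = 2⁻¹²⁰/(klEngPsq P²·klEngRsq R⁴·(c²+1))`, `R.Gfr j ≤ klEngRsq R` (`gfr_le_klEngRsq`, …DefsQ2), `klEngGeo14.S 1 = max 2¹⁰ 2⁶⁴`, `(klEngQ9dG klEngGeo14 P R).S' 1 = max s (2⁶⁴·s)` with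
`s = 2⁶⁰·klEngPsq P²·klEngRsq R²`, `curveExtC X c 1 = 2000·X·(2π+1)·c 1 ≤ 2⁶⁰·c 1` for `X ∈ {X₄, 65550}`, `π⁸ < 2¹⁴`.
* `rowCC_udoor_le` — the master inequality `… ≤ 1/512` for any table constant `X` with `0 ≤ curveExtC X · 1 ≤ 2⁶⁰ · (·)` on the two jet constants;
* **`rowCC_hdoor`** (l.54, `≤ 1/128`) and **`rowCC_hdoor₁`** (l.201, `≤ 1/512`) — the two rows VERBATIM.
So, after «(C)-HRES-GFR0-VACUITY» (p2 g27 memo HRES-VACUITY.md), the ONLY non-producer, non-arithmetic residual of `hres` is the conjunct `0 < R.Gfr 0`.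
Pure real arithmetic over landed doors (no definition, no instance, no notation); nothing here asserts (C), any row of 20437, VL, K3, the Kohn–Luttinger margin or
superconductivity in the Hubbard model.  0 kit · 0 lit.  References: BGM 2006 §3 (3.2) (the size of the frame pieces along the flow) [cite: BenfattoGiulianiMastropietro2006].
-/

noncomputable section

namespace Summit.HubbardSuperconductivity.HubbardSuperconductivity.Theorems.EngineV8

set_option linter.dupNamespace false -- summit = problem name (single-conjunct summit), D-0017

open Real Finset
open Summit.HubbardSuperconductivity.HubbardSuperconductivity.Theorems.KLRegimeSplit

/-! ## §1 Numeric facts -/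

/-- `π⁸ < 2¹⁴`. [cite: BenfattoGiulianiMastropietro2006, §3 (3.2)] -/
theorem pi_pow_eight_lt_two_pow : Real.pi ^ 8 < (2 : ℝ) ^ 14 := by
  have hπ : π < 3.1416 := Real.pi_lt_d4
  have hπ0 : 0 < π := Real.pi_pos
  have hπ2 : π ^ 2 < 9.87 := by nlinarith
  have h20 : 0 ≤ π ^ 2 := by positivity
  have hπ4 : π ^ 4 < 97.42 := by
    have h := mul_lt_mul'' hπ2 hπ2 h20 h20
    have e : π ^ 4 = π ^ 2 * π ^ 2 := by ring
    rw [e]; linarith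
  have h40 : 0 ≤ π ^ 4 := by positivity
  have h := mul_lt_mul'' hπ4 hπ4 h40 h40
  have e : π ^ 8 = π ^ 4 * π ^ 4 := by ring
  rw [e]; linarith

/-- `curveExtC X₄ c 1 ≤ 2⁶⁰·c 1` for `X₄ = 8·576·342⁴` (`2000·X₄·(2π+1) ≈ 9.2·10¹⁷ < 2⁶⁰`). [cite: BenfattoGiulianiMastropietro2006, §3 (3.2)] -/
theorem curveExtC_X4_one_le {c : ℕ → ℝ} (hc : 0 ≤ c 1) : curveExtC (8 * 576 * (342 : ℝ) ^ 4) c 1 ≤ 2 ^ 60 * c 1 := by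
  rw [curveExtC_one]
  have hπ : π < 3.1416 := Real.pi_lt_d4
  have h1 : 2000 * (8 * 576 * (342 : ℝ) ^ 4) * (2 * π + 1) ≤ 2 ^ 60 := by nlinarith
  exact mul_le_mul_of_nonneg_right h1 hc

/-- `curveExtC 65550 c 1 ≤ 2⁶⁰·c 1` (the last-index table constant `klChi2CauchyTab2 4`; sharper `≤ 2³⁰·c 1` is `curveExtC_klChi2CauchyTab2_four_one_le`).
[cite: BenfattoGiulianiMastropietro2006, §3 (3.2)] -/
theorem curveExtC_tab2_four_one_le' {c : ℕ → ℝ} (hc : 0 ≤ c 1) : curveExtC (klChi2CauchyTab2 4) c 1 ≤ 2 ^ 60 * c 1 :=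
  (curveExtC_klChi2CauchyTab2_four_one_le hc).trans (mul_le_mul_of_nonneg_right (pow_le_pow_right₀ (by norm_num) (by norm_num)) hc)

/-- `klEngGeo14.S 1 = 2⁶⁴` (`= max (klEngGeo3.S 1) (klS6 1) = max 2¹⁰ 2⁶⁴`). [cite: BenfattoGiulianiMastropietro2006, §3 (3.2)] -/
theorem klEngGeo14_S_one : klEngGeo14.S 1 = 2 ^ 64 := by
  have h : klEngGeo14.S 1 = max (klEngGeo3.S 1) (klS6 1) := rfl
  have h3 : klEngGeo3.S 1 = 2 ^ 10 := rfl
  rw [h, h3, klS6_eq]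
  exact max_eq_right (by norm_num)

/-- `(klEngQ9dG klEngGeo14 P R).S' 1 = 2⁶⁴·(2⁶⁰·klEngPsq P²·klEngRsq R²)`. [cite: BenfattoGiulianiMastropietro2006, §3 (3.2)] -/
theorem klEngQ9dG_klEngGeo14_S'_one (P : SplitConsts) (R : RenConsts) :
    (klEngQ9dG klEngGeo14 P R).S' 1 = 2 ^ 64 * (2 ^ 60 * klEngPsq P ^ 2 * klEngRsq R ^ 2) := by
  have h : (klEngQ9dG klEngGeo14 P R).S' 1 = max ((klEngQ3 P R).S' 1) (klS6' P R 1) := rfl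
  have h3 : (klEngQ3 P R).S' 1 = 2 ^ 60 * klEngPsq P ^ 2 * klEngRsq R ^ 2 := rfl
  have h6 : klS6' P R 1 = 2 ^ 64 * (klEngQ3 P R).S' 1 := rfl
  rw [h, h6, h3]
  have h0 : 0 ≤ 2 ^ 60 * klEngPsq P ^ 2 * klEngRsq R ^ 2 := by
    have := one_le_klEngPsq P; have := one_le_klEngRsq R; positivity
  exact max_eq_right (by nlinarith)

/-- `Σ_{j<5} R.Gfr j ≤ 5·klEngRsq R`. [cite: BenfattoGiulianiMastropietro2006, §3 (3.2)] -/
theorem sum_gfr_le_klEngRsq (R : RenConsts) : ∑ j ∈ range 5, R.Gfr j ≤ 5 * klEngRsq R := by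
  calc ∑ j ∈ range 5, R.Gfr j ≤ ∑ _j ∈ range 5, klEngRsq R := sum_le_sum fun j hj => gfr_le_klEngRsq R (mem_range.1 hj)
    _ = 5 * klEngRsq R := by simp

/-! ## §2 The master inequality and the two rows -/

section UDoor

variable {P : SplitConsts} {R : RenConsts} {c U : ℝ}

/-- **MASTER `U`-DOOR**: for any table constant `X` whose two order-1 extension constants are `≤ 2⁶⁰ ×` the jet constants, the door quantity is `≤ 1/512` below token #14.
Arithmetic: `U ≤ 2⁻¹²⁰/(Psq²·Rsq⁴)`, `Gfr₀ ≤ Rsq`, `ΣGfr ≤ 5Rsq`, `π⁸W/2¹¹ ≤ 2³·(2¹²⁴ + 2¹⁸⁴·Psq²Rsq²·U)`. [cite: BenfattoGiulianiMastropietro2006, §3 (3.2)] -/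
theorem rowCC_udoor_le (hR : R.WF2) (hU : 0 < U) (hUle : U ≤ klEngU₀12GQ klEngGeo14 (klEngQ9dG klEngGeo14 P R) P R c)
    {X : ℝ} (hXS0 : 0 ≤ curveExtC X klEngGeo14.S 1) (hXS : curveExtC X klEngGeo14.S 1 ≤ 2 ^ 60 * klEngGeo14.S 1)
    (hXS'0 : 0 ≤ curveExtC X (klEngQ9dG klEngGeo14 P R).S' 1) (hXS' : curveExtC X (klEngQ9dG klEngGeo14 P R).S' 1 ≤ 2 ^ 60 * (klEngQ9dG klEngGeo14 P R).S' 1) :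
    R.Gfr 0 * |U| + ((∑ j ∈ range 5, R.Gfr j) + Real.pi ^ 8 * (curveExtC X klEngGeo14.S 1 + curveExtC X (klEngQ9dG klEngGeo14 P R).S' 1 * |U|) / 2 ^ 11) * U ^ 2 ≤
      1 / 512 := by
  -- abbreviations
  set Psq : ℝ := klEngPsq P with hPsq
  set Rsq : ℝ := klEngRsq R with hRsq
  have hP1 : 1 ≤ Psq := one_le_klEngPsq P
  have hR1 : 1 ≤ Rsq := one_le_klEngRsq R
  have hUabs : |U| = U := abs_of_pos hU
  rw [hUabs]
  -- the token: `U ≤ 2⁻¹²⁰/(Psq² Rsq⁴ (c²+1))`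
  have hU3 : U ≤ 1 / ((2 : ℝ) ^ 120 * Psq ^ 2 * Rsq ^ 4 * (c ^ 2 + 1)) :=
    hUle.trans (klEngU₀12GQ_le_klEngU₀3 klEngGeo14 (klEngQ9dG klEngGeo14 P R) P R c)
  have hden : (2 : ℝ) ^ 120 * Psq ^ 2 * Rsq ^ 4 ≤ (2 : ℝ) ^ 120 * Psq ^ 2 * Rsq ^ 4 * (c ^ 2 + 1) := by
    have : (1 : ℝ) ≤ c ^ 2 + 1 := by nlinarith [sq_nonneg c]
    have h0 : 0 ≤ (2 : ℝ) ^ 120 * Psq ^ 2 * Rsq ^ 4 := by positivity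
    nlinarith
  have hU2 : U ≤ 1 / ((2 : ℝ) ^ 120 * Psq ^ 2 * Rsq ^ 4) :=
    hU3.trans (one_div_le_one_div_of_le (by positivity) hden)
  -- `D := 2¹²⁰ Psq² Rsq⁴ ≥ 2¹²⁰`, `U·D ≤ 1`
  set D : ℝ := (2 : ℝ) ^ 120 * Psq ^ 2 * Rsq ^ 4 with hD
  have hD0 : 0 < D := by positivity
  have hUD : U * D ≤ 1 := by rwa [le_div_iff₀ hD0] at hU2
  -- constants
  have hG : klEngGeo14.S 1 = 2 ^ 64 := klEngGeo14_S_one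
  have hQ : (klEngQ9dG klEngGeo14 P R).S' 1 = 2 ^ 64 * (2 ^ 60 * Psq ^ 2 * Rsq ^ 2) := klEngQ9dG_klEngGeo14_S'_one P R
  have hπ8 : Real.pi ^ 8 < (2 : ℝ) ^ 14 := pi_pow_eight_lt_two_pow
  have hπ80 : 0 ≤ Real.pi ^ 8 := by positivity
  have hG0 : R.Gfr 0 ≤ Rsq := gfr_le_klEngRsq R (by norm_num)
  have hG00 : 0 ≤ R.Gfr 0 := hR.1.2.2 0
  have hS : ∑ j ∈ range 5, R.Gfr j ≤ 5 * Rsq := sum_gfr_le_klEngRsq R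
  have hS0 : 0 ≤ ∑ j ∈ range 5, R.Gfr j := sum_nonneg fun j _ => hR.1.2.2 j
  -- `W ≤ 2¹²⁴ + 2¹⁸⁴ Psq² Rsq² U`
  set W : ℝ := curveExtC X klEngGeo14.S 1 + curveExtC X (klEngQ9dG klEngGeo14 P R).S' 1 * U with hW
  have hW0 : 0 ≤ W := by rw [hW]; positivity
  have hWle : W ≤ 2 ^ 124 + 2 ^ 184 * Psq ^ 2 * Rsq ^ 2 * U := by
    rw [hW]
    have h1 : curveExtC X klEngGeo14.S 1 ≤ 2 ^ 124 := by rw [hG] at hXS; linarith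
    have h2 : curveExtC X (klEngQ9dG klEngGeo14 P R).S' 1 * U ≤ 2 ^ 184 * Psq ^ 2 * Rsq ^ 2 * U := by
      have h2' : curveExtC X (klEngQ9dG klEngGeo14 P R).S' 1 ≤ 2 ^ 184 * Psq ^ 2 * Rsq ^ 2 := by rw [hQ] at hXS'; linarith
      exact mul_le_mul_of_nonneg_right h2' hU.le
    linarith
  -- assemble: every term is `≤ 2⁻¹⁰⁰`
  have hUsmall : U ≤ 1 / (2 : ℝ) ^ 120 := by
    refine hU2.trans (one_div_le_one_div_of_le (by positivity) ?_)
    have : (1 : ℝ) ≤ Psq ^ 2 * Rsq ^ 4 := one_le_mul_of_one_le_of_one_le (one_le_pow₀ hP1) (one_le_pow₀ hR1)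
    nlinarith
  -- (i) `Gfr₀ U ≤ Rsq U ≤ 2⁻¹²⁰` since `Rsq ≤ Rsq⁴ Psq²` and `U D ≤ 1`
  have hi : R.Gfr 0 * U ≤ 1 / (2 : ℝ) ^ 120 := by
    have hRD : Rsq * (2 : ℝ) ^ 120 ≤ D := by
      rw [hD]
      have h4 : Rsq ≤ Rsq ^ 4 := le_self_pow₀ hR1 (by norm_num)
      have hp : (1 : ℝ) ≤ Psq ^ 2 := one_le_pow₀ hP1
      have : Rsq ≤ Psq ^ 2 * Rsq ^ 4 := by
        calc Rsq ≤ Rsq ^ 4 := h4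
          _ = 1 * Rsq ^ 4 := by ring
          _ ≤ Psq ^ 2 * Rsq ^ 4 := by gcongr
      nlinarith
    calc R.Gfr 0 * U ≤ Rsq * U := mul_le_mul_of_nonneg_right hG0 hU.le
      _ = Rsq * (2 : ℝ) ^ 120 * U / (2 : ℝ) ^ 120 := by ring
      _ ≤ D * U / (2 : ℝ) ^ 120 := by gcongr
      _ ≤ 1 / (2 : ℝ) ^ 120 := by rw [mul_comm] at hUD; gcongr
  -- (ii) `(ΣGfr) U² ≤ 5 (Rsq U) U ≤ 5·2⁻¹²⁰·1`
  have hii : (∑ j ∈ range 5, R.Gfr j) * U ^ 2 ≤ 5 / (2 : ℝ) ^ 120 := by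
    have hRD : Rsq * (2 : ℝ) ^ 120 ≤ D := by
      rw [hD]
      have h4 : Rsq ≤ Rsq ^ 4 := le_self_pow₀ hR1 (by norm_num)
      have hp : (1 : ℝ) ≤ Psq ^ 2 := one_le_pow₀ hP1
      have : Rsq ≤ Psq ^ 2 * Rsq ^ 4 := by
        calc Rsq ≤ Rsq ^ 4 := h4
          _ = 1 * Rsq ^ 4 := by ring
          _ ≤ Psq ^ 2 * Rsq ^ 4 := by gcongr
      nlinarith
    have hRU : Rsq * U ≤ 1 / (2 : ℝ) ^ 120 := by
      calc Rsq * U = Rsq * (2 : ℝ) ^ 120 * U / (2 : ℝ) ^ 120 := by ring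
        _ ≤ D * U / (2 : ℝ) ^ 120 := by gcongr
        _ ≤ 1 / (2 : ℝ) ^ 120 := by rw [mul_comm] at hUD; gcongr
    have hU1 : U ≤ 1 := hUsmall.trans (by norm_num)
    have hRU0 : 0 ≤ Rsq * U := by positivity
    have h1 : (∑ j ∈ range 5, R.Gfr j) * U ^ 2 ≤ 5 * Rsq * U ^ 2 := mul_le_mul_of_nonneg_right hS (sq_nonneg U)
    have h2 : 5 * Rsq * U ^ 2 = 5 * (Rsq * U) * U := by ring
    have h3 : 5 * (Rsq * U) * U ≤ 5 * (1 / (2 : ℝ) ^ 120) * 1 := by gcongr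
    linarith
  -- (iii) the `W` term: `π⁸ W U²/2¹¹ ≤ 2³ (2¹²⁴ U² + 2¹⁸⁴ Psq²Rsq² U³) ≤ 2³(2¹²⁴·2⁻²⁴⁰ + 2¹⁸⁴·2⁻¹²⁰·2⁻²⁴⁰)`-class
  have hiii : Real.pi ^ 8 * W / 2 ^ 11 * U ^ 2 ≤ 1 / (2 : ℝ) ^ 100 := by
    have hPRU : Psq ^ 2 * Rsq ^ 2 * U ≤ 1 / (2 : ℝ) ^ 120 := by
      have hRD : Psq ^ 2 * Rsq ^ 2 * (2 : ℝ) ^ 120 ≤ D := by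
        rw [hD]
        have h24 : Rsq ^ 2 ≤ Rsq ^ 4 := pow_le_pow_right₀ hR1 (by norm_num)
        have : Psq ^ 2 * Rsq ^ 2 ≤ Psq ^ 2 * Rsq ^ 4 := mul_le_mul_of_nonneg_left h24 (by positivity)
        nlinarith
      calc Psq ^ 2 * Rsq ^ 2 * U = Psq ^ 2 * Rsq ^ 2 * (2 : ℝ) ^ 120 * U / (2 : ℝ) ^ 120 := by ring
        _ ≤ D * U / (2 : ℝ) ^ 120 := by gcongr
        _ ≤ 1 / (2 : ℝ) ^ 120 := by rw [mul_comm] at hUD; gcongr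
    have hW' : W ≤ 2 ^ 124 + 2 ^ 64 := by
      calc W ≤ 2 ^ 124 + 2 ^ 184 * Psq ^ 2 * Rsq ^ 2 * U := hWle
        _ = 2 ^ 124 + 2 ^ 184 * (Psq ^ 2 * Rsq ^ 2 * U) := by ring
        _ ≤ 2 ^ 124 + 2 ^ 184 * (1 / (2 : ℝ) ^ 120) := by gcongr
        _ = 2 ^ 124 + 2 ^ 64 := by norm_num
    have hU2' : U ^ 2 ≤ (1 / (2 : ℝ) ^ 120) ^ 2 := pow_le_pow_left₀ hU.le hUsmall 2
    have hπ8le : Real.pi ^ 8 ≤ (2 : ℝ) ^ 14 := hπ8.le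
    calc Real.pi ^ 8 * W / 2 ^ 11 * U ^ 2 ≤ (2 : ℝ) ^ 14 * (2 ^ 124 + 2 ^ 64) / 2 ^ 11 * (1 / (2 : ℝ) ^ 120) ^ 2 := by
          gcongr
      _ ≤ 1 / (2 : ℝ) ^ 100 := by norm_num
  -- sum
  have htot : R.Gfr 0 * U + ((∑ j ∈ range 5, R.Gfr j) + Real.pi ^ 8 * W / 2 ^ 11) * U ^ 2 =
      R.Gfr 0 * U + (∑ j ∈ range 5, R.Gfr j) * U ^ 2 + Real.pi ^ 8 * W / 2 ^ 11 * U ^ 2 := by ring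
  rw [htot]
  have : 1 / (2 : ℝ) ^ 120 + 5 / (2 : ℝ) ^ 120 + 1 / (2 : ℝ) ^ 100 ≤ 1 / 512 := by norm_num
  linarith

/-- **ROW (C)'s regular `U`-door (CGQInst l.54) from token #14.** [cite: BenfattoGiulianiMastropietro2006, §3 (3.2)] -/
theorem rowCC_hdoor (hR : R.WF2) (hU : 0 < U) (hUle : U ≤ klEngU₀12GQ klEngGeo14 (klEngQ9dG klEngGeo14 P R) P R c) :
    R.Gfr 0 * |U| + ((∑ j ∈ range 5, R.Gfr j) + Real.pi ^ 8 * (curveExtC (8 * 576 * (342 : ℝ) ^ 4) klEngGeo14.S 1 +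
      curveExtC (8 * 576 * (342 : ℝ) ^ 4) (klEngQ9dG klEngGeo14 P R).S' 1 * |U|) / 2 ^ 11) * U ^ 2 ≤ 1 / 128 := by
  have hS0 : 0 ≤ klEngGeo14.S 1 := by rw [klEngGeo14_S_one]; positivity
  have hS'0 : 0 ≤ (klEngQ9dG klEngGeo14 P R).S' 1 := by
    rw [klEngQ9dG_klEngGeo14_S'_one]; have := one_le_klEngPsq P; have := one_le_klEngRsq R; positivity
  have hX0 : 0 ≤ 8 * 576 * (342 : ℝ) ^ 4 := by positivity
  refine (rowCC_udoor_le hR hU hUle ?_ (curveExtC_X4_one_le hS0) ?_ (curveExtC_X4_one_le hS'0)).trans (by norm_num)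
  · rw [curveExtC_one]; positivity
  · rw [curveExtC_one]; positivity

/-- **ROW (C)'s last-index `U`-door (CGQInst l.201, table constant `klChi2CauchyTab2 4 = 65550`) from token #14.** [cite: BenfattoGiulianiMastropietro2006, §3 (3.2)] -/
theorem rowCC_hdoor₁ (hR : R.WF2) (hU : 0 < U) (hUle : U ≤ klEngU₀12GQ klEngGeo14 (klEngQ9dG klEngGeo14 P R) P R c) :
    R.Gfr 0 * |U| + ((∑ j ∈ range 5, R.Gfr j) + Real.pi ^ 8 * (curveExtC (klChi2CauchyTab2 4) klEngGeo14.S 1 +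
      curveExtC (klChi2CauchyTab2 4) (klEngQ9dG klEngGeo14 P R).S' 1 * |U|) / 2 ^ 11) * U ^ 2 ≤ 1 / 512 := by
  have hS0 : 0 ≤ klEngGeo14.S 1 := by rw [klEngGeo14_S_one]; positivity
  have hS'0 : 0 ≤ (klEngQ9dG klEngGeo14 P R).S' 1 := by
    rw [klEngQ9dG_klEngGeo14_S'_one]; have := one_le_klEngPsq P; have := one_le_klEngRsq R; positivity
  have hX : klChi2CauchyTab2 4 = 65550 := by norm_num [klChi2CauchyTab2]
  refine rowCC_udoor_le hR hU hUle ?_ (curveExtC_tab2_four_one_le' hS0) ?_ (curveExtC_tab2_four_one_le' hS'0)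
  · rw [curveExtC_one, hX]; positivity
  · rw [curveExtC_one, hX]; positivity

end UDoor

end Summit.HubbardSuperconductivity.HubbardSuperconductivity.Theorems.EngineV8

end
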